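/-
  HodgeLocusCensusUnitColumnRankExceptionalPrimes.lean — pub-hlocus ENGINE B (ivhs-2, gen 55), PROBE 18 (successor material; probe-only until worded).
  certified instances and evidence bearing on the general Hodge conjecture; no claim.

  KERNEL RANK THEOREMS (evidence class; no census number changes; nothing about HC). THE EXCEPTIONAL PRIMES OF THE UNIT COLUMN OF ×q^c, EXPLICITLY.
  For a prime p, a field K of characteristic p, a field K₀ of characteristic 0 and anchor 229's multiplicity matrix of ×q^c on K[x₁,…,x_k]/(xᵢ^{e+2})
  at level j (VERBATIM, as in anchors 230/294/296), HEADLINE (`exceptional_iff`): for 0 < c,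
      (∃ j, rank_K(j) < rank_{K₀}(j)) ↔ c ≤ k ∧ (p ≤ c ∨ 2p ≤ k + c),
  i.e. the unit column of ×q^c on k variables (any degree e + 2 ≥ 2) has an exceptional prime iff c ≤ k, and then the exceptional primes are
  exactly the primes p ≤ max (c, ⌊(k + c)/2⌋). INGREDIENTS: (E5) `rank_eq_zero_of_lt`: for k < c the column index type is empty (degree
  bookkeeping), so the rank is 0 over every field; (E6) `rank_charZero_level_zero_pos`: for c ≤ k the characteristic-0 rank at level 0 is positive
  (THEOREM L, anchor 229's `rank_mulDeltaPow_levels`: the zero label contributes min (C(k,0), C(k,c)) = 1); (E7) `exists_rank_charZero_pos_iff`: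
  (∃ j, 0 < rank_{K₀}(j)) ↔ c ≤ k; (E1) `rank_charP_le_rank_charZero_prime`: rank_K ≤ rank_{K₀} at every level for EVERY prime p (anchor 296 for
  c < p; anchor 230's `rank_mulDeltaPow_levels_eq_zero_of_charP` for p ≤ c); (E2) `exists_rank_charP_lt_iff_of_prime_le`: for p ≤ c a drop at some
  level ⇔ the characteristic-0 column is non-zero at some level; (E3) `exists_rank_charP_lt_iff_prime`: for 0 < c, (∃ j, drop) ↔ (p ≤ c ∧ ∃ j,
  0 < rank_{K₀}(j)) ∨ (c < p ∧ 2p ≤ k + c) (anchor 296's `exists_rank_charP_lt_iff` supplies the branch c < p); (E9) `not_exists_rank_charP_lt_of_lt`: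
  no drop anywhere when k < c. 8 theorems, 0 defs; imports PROBE 17 = anchor 296 `…HodgeLocusCensusUnitColumnRankLevelsCriterion` by name (hence
  294, 293, 230, 229); nothing restated but anchor 229's matrix (VERBATIM); no sorries, axioms, instances or notation.
-/
import Summits.HodgeConjecture.HodgeConjecture.Theorems.HodgeLocusCensusUnitColumnRankLevelsCriterion

set_option linter.dupNamespace false
set_option autoImplicit false

namespace Summit.HodgeConjecture.HodgeConjecture.HodgeLocus.Census.UnitColumnRankExceptionalPrimes

open Summit.HodgeConjecture.HodgeConjecture.HodgeLocus.Census.ModelNonJumpC1All (colR)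
open Summit.HodgeConjecture.HodgeConjecture.HodgeLocus.Census.UnitColumnRankLevelsPowers (rank_mulDeltaPow_levels)
open Summit.HodgeConjecture.HodgeConjecture.HodgeLocus.Census.UnitColumnRankLevelsChar (rank_mulDeltaPow_levels_eq_zero_of_charP)
open Summit.HodgeConjecture.HodgeConjecture.HodgeLocus.Census.UnitColumnRankLevelsCriterion (rank_charP_le_rank_charZero
  exists_rank_charP_lt_iff)

/-! ## §1 when is the unit column of `×q^c` non-zero? (`c ≤ k`) -/

/-- (E5) `k < c`: degree bookkeeping leaves NO column index (`Σ mᵢ + j + c(e+1) = k(e+1)` is impossible since `c(e+1) ≥ (k+1)(e+1)`),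
so the matrix has rank `0` over every field. -/
theorem rank_eq_zero_of_lt (K : Type*) [Field K] (k e c j : ℕ) (hkc : k < c) :
    (Matrix.of fun (v : {v : Fin k → Fin (e + 2) // (∑ i, (v i : ℕ)) + j = k * (e + 1)})
        (m : {m : Fin k → Fin (e + 2) // (∑ i, (m i : ℕ)) + (j + c * (e + 1)) = k * (e + 1)}) =>
      ((((List.flatMap (colR (e + 3)))^[c] [List.ofFn (fun i => (m.1 i : ℕ))]).count (List.ofFn (fun i => (v.1 i : ℕ))) : ℕ) : K)).rank = 0 := by
  apply Nat.eq_zero_of_le_zero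
  refine (Matrix.rank_le_card_width _).trans (le_of_eq ?_)
  rw [Fintype.card_eq_zero_iff]
  refine ⟨fun m => ?_⟩
  have h1 : (∑ i, (m.1 i : ℕ)) + (j + c * (e + 1)) = k * (e + 1) := m.2
  have h2 : (k + 1) * (e + 1) ≤ c * (e + 1) := Nat.mul_le_mul_right _ hkc
  rw [Nat.succ_mul] at h2
  omega

/-- (E6) `c ≤ k`: at level `0` the characteristic-`0` rank is POSITIVE — in THEOREM L (anchor 229's `rank_mulDeltaPow_levels`) the zero label
is feasible and contributes `min (C(k,0), C(k,c)) = 1`. -/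
theorem rank_charZero_level_zero_pos (K₀ : Type*) [Field K₀] [CharZero K₀] (k e c : ℕ) (hck : c ≤ k) :
    0 < (Matrix.of fun (v : {v : Fin k → Fin (e + 2) // (∑ i, (v i : ℕ)) + 0 = k * (e + 1)})
        (m : {m : Fin k → Fin (e + 2) // (∑ i, (m i : ℕ)) + (0 + c * (e + 1)) = k * (e + 1)}) =>
      ((((List.flatMap (colR (e + 3)))^[c] [List.ofFn (fun i => (m.1 i : ℕ))]).count (List.ofFn (fun i => (v.1 i : ℕ))) : ℕ) : K₀)).rank := by
  rw [rank_mulDeltaPow_levels K₀ k e c 0]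
  refine lt_of_lt_of_le ?_ (Finset.single_le_sum (fun μ _ => Nat.zero_le _) (Finset.mem_univ (fun _ : Fin k => (0 : Fin (e + 1)))))
  simp [Nat.choose_pos hck]

/-- (E7) POSITIVITY CRITERION: the characteristic-`0` unit column of `×q^c` is non-zero at some level iff `c ≤ k` ((E5), (E6)). -/
theorem exists_rank_charZero_pos_iff (K₀ : Type*) [Field K₀] [CharZero K₀] (k e c : ℕ) :
    (∃ j : ℕ, 0 < (Matrix.of fun (v : {v : Fin k → Fin (e + 2) // (∑ i, (v i : ℕ)) + j = k * (e + 1)})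
        (m : {m : Fin k → Fin (e + 2) // (∑ i, (m i : ℕ)) + (j + c * (e + 1)) = k * (e + 1)}) =>
      ((((List.flatMap (colR (e + 3)))^[c] [List.ofFn (fun i => (m.1 i : ℕ))]).count (List.ofFn (fun i => (v.1 i : ℕ))) : ℕ) : K₀)).rank) ↔ c ≤ k := by
  constructor
  · rintro ⟨j, hj⟩
    by_contra h
    rw [rank_eq_zero_of_lt K₀ k e c j (Nat.lt_of_not_le h)] at hj
    exact lt_irrefl 0 hj
  · intro h
    exact ⟨0, rank_charZero_level_zero_pos K₀ k e c h⟩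

/-! ## §2 every prime: the characteristic-`p` rank never exceeds THEOREM L's -/

/-- (E1) for EVERY prime `p` and all `k e c j`: the rank over `K` (characteristic `p`) is at most the rank over `K₀` (characteristic `0`):
anchor 296's `rank_charP_le_rank_charZero` when `c < p`, and `0 ≤ _` after anchor 230's vanishing when `p ≤ c`. -/
theorem rank_charP_le_rank_charZero_prime (K K₀ : Type*) [Field K] [Field K₀] (p : ℕ) [CharP K p] [CharZero K₀] (hp : p.Prime)
    (k e c j : ℕ) :
    (Matrix.of fun (v : {v : Fin k → Fin (e + 2) // (∑ i, (v i : ℕ)) + j = k * (e + 1)})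
        (m : {m : Fin k → Fin (e + 2) // (∑ i, (m i : ℕ)) + (j + c * (e + 1)) = k * (e + 1)}) =>
      ((((List.flatMap (colR (e + 3)))^[c] [List.ofFn (fun i => (m.1 i : ℕ))]).count (List.ofFn (fun i => (v.1 i : ℕ))) : ℕ) : K)).rank ≤
    (Matrix.of fun (v : {v : Fin k → Fin (e + 2) // (∑ i, (v i : ℕ)) + j = k * (e + 1)})
        (m : {m : Fin k → Fin (e + 2) // (∑ i, (m i : ℕ)) + (j + c * (e + 1)) = k * (e + 1)}) =>
      ((((List.flatMap (colR (e + 3)))^[c] [List.ofFn (fun i => (m.1 i : ℕ))]).count (List.ofFn (fun i => (v.1 i : ℕ))) : ℕ) : K₀)).rank := by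
  by_cases hcp : c < p
  · exact rank_charP_le_rank_charZero K K₀ p hp k e c j hcp
  · rw [rank_mulDeltaPow_levels_eq_zero_of_charP K p hp k e c j (Nat.le_of_not_lt hcp)]
    exact Nat.zero_le _

/-! ## §3 the exceptional primes of `(k, e, c)` -/

/-- (E2) `p ≤ c`: the characteristic-`p` column vanishes at every level (anchor 230), so SOME level drops iff the characteristic-`0`
column is non-zero at SOME level. -/
theorem exists_rank_charP_lt_iff_of_prime_le (K K₀ : Type*) [Field K] [Field K₀] (p : ℕ) [CharP K p] [CharZero K₀] (hp : p.Prime)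
    (k e c : ℕ) (hpc : p ≤ c) :
    (∃ j : ℕ, (Matrix.of fun (v : {v : Fin k → Fin (e + 2) // (∑ i, (v i : ℕ)) + j = k * (e + 1)})
        (m : {m : Fin k → Fin (e + 2) // (∑ i, (m i : ℕ)) + (j + c * (e + 1)) = k * (e + 1)}) =>
      ((((List.flatMap (colR (e + 3)))^[c] [List.ofFn (fun i => (m.1 i : ℕ))]).count (List.ofFn (fun i => (v.1 i : ℕ))) : ℕ) : K)).rank <
    (Matrix.of fun (v : {v : Fin k → Fin (e + 2) // (∑ i, (v i : ℕ)) + j = k * (e + 1)})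
        (m : {m : Fin k → Fin (e + 2) // (∑ i, (m i : ℕ)) + (j + c * (e + 1)) = k * (e + 1)}) =>
      ((((List.flatMap (colR (e + 3)))^[c] [List.ofFn (fun i => (m.1 i : ℕ))]).count (List.ofFn (fun i => (v.1 i : ℕ))) : ℕ) : K₀)).rank) ↔
    ∃ j : ℕ, 0 < (Matrix.of fun (v : {v : Fin k → Fin (e + 2) // (∑ i, (v i : ℕ)) + j = k * (e + 1)})
        (m : {m : Fin k → Fin (e + 2) // (∑ i, (m i : ℕ)) + (j + c * (e + 1)) = k * (e + 1)}) =>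
      ((((List.flatMap (colR (e + 3)))^[c] [List.ofFn (fun i => (m.1 i : ℕ))]).count (List.ofFn (fun i => (v.1 i : ℕ))) : ℕ) : K₀)).rank := by
  refine exists_congr fun j => ?_
  rw [rank_mulDeltaPow_levels_eq_zero_of_charP K p hp k e c j hpc]

/-- (E3) THE EXCEPTIONAL-PRIME SET: for a prime `p` and `0 < c`, some level of the unit column of `×q^c` has smaller rank in
characteristic `p` than in characteristic `0` iff EITHER `p ≤ c` and the characteristic-`0` column is non-zero at some level, OR `c < p` and
`2p ≤ k + c` (anchor 296's `exists_rank_charP_lt_iff`). -/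
theorem exists_rank_charP_lt_iff_prime (K K₀ : Type*) [Field K] [Field K₀] (p : ℕ) [CharP K p] [CharZero K₀] (hp : p.Prime)
    (k e c : ℕ) (hc : 0 < c) :
    (∃ j : ℕ, (Matrix.of fun (v : {v : Fin k → Fin (e + 2) // (∑ i, (v i : ℕ)) + j = k * (e + 1)})
        (m : {m : Fin k → Fin (e + 2) // (∑ i, (m i : ℕ)) + (j + c * (e + 1)) = k * (e + 1)}) =>
      ((((List.flatMap (colR (e + 3)))^[c] [List.ofFn (fun i => (m.1 i : ℕ))]).count (List.ofFn (fun i => (v.1 i : ℕ))) : ℕ) : K)).rank <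
    (Matrix.of fun (v : {v : Fin k → Fin (e + 2) // (∑ i, (v i : ℕ)) + j = k * (e + 1)})
        (m : {m : Fin k → Fin (e + 2) // (∑ i, (m i : ℕ)) + (j + c * (e + 1)) = k * (e + 1)}) =>
      ((((List.flatMap (colR (e + 3)))^[c] [List.ofFn (fun i => (m.1 i : ℕ))]).count (List.ofFn (fun i => (v.1 i : ℕ))) : ℕ) : K₀)).rank) ↔
    (p ≤ c ∧ ∃ j : ℕ, 0 < (Matrix.of fun (v : {v : Fin k → Fin (e + 2) // (∑ i, (v i : ℕ)) + j = k * (e + 1)})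
        (m : {m : Fin k → Fin (e + 2) // (∑ i, (m i : ℕ)) + (j + c * (e + 1)) = k * (e + 1)}) =>
      ((((List.flatMap (colR (e + 3)))^[c] [List.ofFn (fun i => (m.1 i : ℕ))]).count (List.ofFn (fun i => (v.1 i : ℕ))) : ℕ) : K₀)).rank) ∨
      (c < p ∧ 2 * p ≤ k + c) := by
  by_cases hcp : c < p
  · rw [exists_rank_charP_lt_iff K K₀ p hp k e c hc hcp]
    constructor
    · intro h
      exact Or.inr ⟨hcp, h⟩
    · rintro (⟨hpc, -⟩ | ⟨-, h⟩)
      · exact absurd hpc (Nat.not_le_of_lt hcp)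
      · exact h
  · have hpc : p ≤ c := Nat.le_of_not_lt hcp
    rw [exists_rank_charP_lt_iff_of_prime_le K K₀ p hp k e c hpc]
    constructor
    · intro h
      exact Or.inl ⟨hpc, h⟩
    · rintro (⟨-, h⟩ | ⟨h', -⟩)
      · exact h
      · exact absurd h' hcp

/-- (E9) `k < c`: no level drops (both ranks are `0` by (E5)) — any fields `K`, `K₀`. -/
theorem not_exists_rank_charP_lt_of_lt (K K₀ : Type*) [Field K] [Field K₀]
    (k e c : ℕ) (hkc : k < c) :
    ¬ ∃ j : ℕ, (Matrix.of fun (v : {v : Fin k → Fin (e + 2) // (∑ i, (v i : ℕ)) + j = k * (e + 1)})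
        (m : {m : Fin k → Fin (e + 2) // (∑ i, (m i : ℕ)) + (j + c * (e + 1)) = k * (e + 1)}) =>
      ((((List.flatMap (colR (e + 3)))^[c] [List.ofFn (fun i => (m.1 i : ℕ))]).count (List.ofFn (fun i => (v.1 i : ℕ))) : ℕ) : K)).rank <
    (Matrix.of fun (v : {v : Fin k → Fin (e + 2) // (∑ i, (v i : ℕ)) + j = k * (e + 1)})
        (m : {m : Fin k → Fin (e + 2) // (∑ i, (m i : ℕ)) + (j + c * (e + 1)) = k * (e + 1)}) =>
      ((((List.flatMap (colR (e + 3)))^[c] [List.ofFn (fun i => (m.1 i : ℕ))]).count (List.ofFn (fun i => (v.1 i : ℕ))) : ℕ) : K₀)).rank := by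
  rintro ⟨j, hj⟩
  rw [rank_eq_zero_of_lt K₀ k e c j hkc] at hj
  exact Nat.not_lt_zero _ hj

/-- (E10) HEADLINE — THE EXCEPTIONAL PRIMES OF `(k, e, c)`, EXPLICITLY: for a prime `p` and `0 < c`, some level of the unit column of `×q^c`
has smaller rank in characteristic `p` than in characteristic `0` iff `c ≤ k ∧ (p ≤ c ∨ 2p ≤ k + c)`; so for `c ≤ k` the exceptional primes
are exactly the primes `p ≤ max (c, ⌊(k + c)/2⌋)`, in every degree `e + 2 ≥ 2`, and for `k < c` there are none ((E3), (E7)). -/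
theorem exceptional_iff (K K₀ : Type*) [Field K] [Field K₀] (p : ℕ) [CharP K p] [CharZero K₀] (hp : p.Prime)
    (k e c : ℕ) (hc : 0 < c) :
    (∃ j : ℕ, (Matrix.of fun (v : {v : Fin k → Fin (e + 2) // (∑ i, (v i : ℕ)) + j = k * (e + 1)})
        (m : {m : Fin k → Fin (e + 2) // (∑ i, (m i : ℕ)) + (j + c * (e + 1)) = k * (e + 1)}) =>
      ((((List.flatMap (colR (e + 3)))^[c] [List.ofFn (fun i => (m.1 i : ℕ))]).count (List.ofFn (fun i => (v.1 i : ℕ))) : ℕ) : K)).rank <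
    (Matrix.of fun (v : {v : Fin k → Fin (e + 2) // (∑ i, (v i : ℕ)) + j = k * (e + 1)})
        (m : {m : Fin k → Fin (e + 2) // (∑ i, (m i : ℕ)) + (j + c * (e + 1)) = k * (e + 1)}) =>
      ((((List.flatMap (colR (e + 3)))^[c] [List.ofFn (fun i => (m.1 i : ℕ))]).count (List.ofFn (fun i => (v.1 i : ℕ))) : ℕ) : K₀)).rank) ↔
    c ≤ k ∧ (p ≤ c ∨ 2 * p ≤ k + c) := by
  rw [exists_rank_charP_lt_iff_prime K K₀ p hp k e c hc, exists_rank_charZero_pos_iff K₀ k e c]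
  constructor
  · rintro (⟨h1, h2⟩ | ⟨h1, h2⟩)
    · exact ⟨h2, Or.inl h1⟩
    · exact ⟨by omega, Or.inr h2⟩
  · rintro ⟨hck, h | h⟩
    · exact Or.inl ⟨h, hck⟩
    · by_cases hcp : c < p
      · exact Or.inr ⟨hcp, h⟩
      · exact Or.inl ⟨Nat.le_of_not_lt hcp, hck⟩

end Summit.HodgeConjecture.HodgeConjecture.HodgeLocus.Census.UnitColumnRankExceptionalPrimes
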